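import Literature.AlgebraicGeometry.Motives.FiniteQuotientRecognition
import Literature.AlgebraicGeometry.Motives.FiniteQuotientBaseChange
import Literature.AlgebraicGeometry.Morphisms.CofanPieceFactorization
import HarnessLib

/-!
# A quotient by a finite group, read PIECE BY PIECE: the map from a connected piece of `X` to its piece of `Y = X/Δ` is the
# quotient by the STABILISER of the piece (SGA 1 V §1; Mumford, *Abelian Varieties* §7)

Topic `AlgebraicGeometry/Motives`; namespace `Literature.AlgebraicGeometry.Motives`.  THEOREMS ONLY (no definition, no named fact, no
instance, no `sorry`).  Setting (over `ℂ`): a finite group `Δ` acting on a PROJECTIVE `ℂ`-scheme `X` (`act : Δ →* Aut X`), a quotient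
`p : X ⟶ Y` by `Δ` for separated test objects (★ `Motives.IsSepQuotient`, [MumfordAV1970] §7) with `Y` separated, and coproduct
decompositions (colimit cofans `ιX : Xp j ⟶ X`, `ιY : Yp i ⟶ Y`) into INTEGRAL pieces — e.g. the connected components of the complex fibre of
a Shimura curve and of its quotient by a level group — with piece maps `t j : Xp j ⟶ Yp (φ j)`, `t j ≫ ιY (φ j) = ιX j ≫ p` (a hypothesis;
★ `exists_fac_of_isColimit_cofan_of_mem` produces them).

* §1 `p(ℂ)` is onto with fibres single `Δ`-orbits (`IsSepQuotient.surjective_map_of_isProjectiveOver`,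
  `IsSepQuotient.exists_map_act_eq_of_map_eq`): `Y ≅ X/Δ` (★ `isoFiniteQuotient_of_isSepQuotient`) + ★ `map_mk_surjective`,
  ★ `exists_pointsAction_eq_of_map_mk_eq` ([SGA1] V Prop. 1.1).
* §2 `Δ` permutes the pieces (★ `CofanPieceFactorization`): `exists_pieceLift`, `pieceIndex_unique`, `pieceLift_unique`; a lift through the
  SAME piece is an automorphism (`exists_aut_of_pieceLift`).
* §3 `exists_subgroup_isSepQuotient_pieceMap`: if `t j (ℂ)` is onto, the lifts through `Xp j` of the elements of `Δ` stabilising the piece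
  form a FINITE subgroup `H ≤ Aut (Xp j)` (injective into `Aut` by construction) and `t j` is a quotient of `Xp j` by `H` for separated test
  objects — recognition ★ `isSepQuotient_of_isProper_of_bijective` ([Springer1998] Thm. 5.2.8; `t j` proper, target smooth integral, fibres
  of `t j (ℂ)` single `H`-orbits by §1–§2).
* §4 `surjective_map_pieceMap`: `t j (ℂ)` IS onto (finitely many pieces): the closed images of the `Xp j′` cover `Y`, the IRREDUCIBLE piece of
  `Yp (φ j)` lies in one of them, and `Δ` moves that piece to `Xp j`; whence the hypothesis-free `exists_subgroup_isSepQuotient_pieceMap'`.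

Cell `hodgecm-mathlib` (D-0151), crux HLiu418 = stmt-HodgeConjecture-24832, road (P) of the d6 socket `SocketRosZ` (item (iv-b)): the transition
`X_N → X_K` of the unitary Shimura curve is the quotient by `K/N` (★ `RecordSystemGS.IsLevelQuotient`), base-changed to `ℂ` by ★
`isSepQuotient_baseChangeHom_of_isProjectiveOver`; the fact (F-P2) `JacobianGaloisCoverNormAdjoint` is applied to CONNECTED pieces, which this
file shows are again finite-group quotients.  Count-neutral; HC_CM is proved only modulo the 7 printed citations until rung 0 closes.

## References
* [SGA1] A. Grothendieck, M. Raynaud, *SGA 1*, Exp. V §1, Prop. 1.1 (`π` surjective, fibres = orbits), Prop. 1.8, Cor. 1.5.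
* [MumfordAV1970] D. Mumford, *Abelian Varieties* (1970), §7 Thm. p. 66 (1), (2) and Remark (categorical quotient).
* [Springer1998] T. A. Springer, *Linear Algebraic Groups* (2nd ed.), Thm. 5.2.8 (p. 85).
* [GortzWedhorn2020] U. Görtz, T. Wedhorn, *Algebraic Geometry I* (2nd ed.), §(3.5) Prop. 3.10, Example 3.11 (p. 73), Lemma 1.19 (1).
-/

noncomputable section

open CategoryTheory CategoryTheory.Limits AlgebraicGeometry
open Literature.AlgebraicGeometry.RelativeSpec

namespace Literature.AlgebraicGeometry.Motives

/-! ### §1 Complex points of a separated quotient of a projective scheme -/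
section Points

variable {Δ : Type} [Group Δ] [Finite Δ] {X Y : SchemeOver ℂ} (act : Δ →* Aut X) (p : X ⟶ Y)

/-- **`p(ℂ) : X(ℂ) → Y(ℂ)` is onto** for a quotient `p` of the projective `X` by the finite `Δ` for separated test objects with `Y`
separated: `Y ≅ X/Δ` under `X` and `π(ℂ) : X(ℂ) → (X/Δ)(ℂ)` is onto. [cite: SGA1, Exp. V, Prop. 1.1] [cite: MumfordAV1970, §7 Thm. p. 66 (Remark)] -/
theorem IsSepQuotient.surjective_map_of_isProjectiveOver (hX : IsProjectiveOver X) (hY : IsSeparated Y.hom)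
    (hp : IsSepQuotient (fun g => act g) p) : Function.Surjective (AlgPoints.map (L := ℂ) p) := by
  haveI : IsProper X.hom := hX.isProper
  haveI : IsSeparated X.hom := inferInstance
  obtain ⟨i, hi⟩ := isoFiniteQuotient_of_isSepQuotient hX act p hY hp
  intro y
  obtain ⟨P, hP⟩ := map_mk_surjective
    (⟨((Over.forget _).mapAut X).comp act, fun g => Over.w (act g).hom⟩ : ActionOver X.hom Δ)
    (ActionOver.forall_exists_stableAffineOpen_of_isProjectiveOver _ hX) (AlgPoints.map i.hom y)
  refine ⟨P, ?_⟩
  have h1 : AlgPoints.map i.hom (AlgPoints.map p P) = AlgPoints.map i.hom y := by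
    rw [← AlgPoints.map_comp_apply, hi, hP]
  have e : ∀ a : AlgPoints Y ℂ, AlgPoints.map i.inv (AlgPoints.map i.hom a) = a := fun a => by
    rw [← AlgPoints.map_comp_apply, Iso.hom_inv_id, AlgPoints.map_id_apply]
  have h2 := congrArg (AlgPoints.map (L := ℂ) i.inv) h1
  rwa [e, e] at h2

/-- **The fibres of `p(ℂ)` are single `Δ`-orbits**: two complex points of `X` with the same image under the quotient map differ by some
`act g` (`Y ≅ X/Δ` and the fibres of `π(ℂ)` are the orbits). [cite: SGA1, Exp. V, Prop. 1.1] [cite: MumfordAV1970, §7 Thm. p. 66 (1)] -/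
theorem IsSepQuotient.exists_map_act_eq_of_map_eq (hX : IsProjectiveOver X) (hY : IsSeparated Y.hom)
    (hp : IsSepQuotient (fun g => act g) p) {P P' : ComplexPoints X} (h : AlgPoints.map p P = AlgPoints.map p P') :
    ∃ g : Δ, AlgPoints.map (act g).hom P = P' := by
  haveI : IsProper X.hom := hX.isProper
  haveI : IsSeparated X.hom := inferInstance
  obtain ⟨i, hi⟩ := isoFiniteQuotient_of_isSepQuotient hX act p hY hp
  have h1 : AlgPoints.map (finiteQuotient.mk
      (⟨((Over.forget _).mapAut X).comp act, fun g => Over.w (act g).hom⟩ : ActionOver X.hom Δ)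
      (ActionOver.forall_exists_stableAffineOpen_of_isProjectiveOver _ hX)) P =
      AlgPoints.map (finiteQuotient.mk
      (⟨((Over.forget _).mapAut X).comp act, fun g => Over.w (act g).hom⟩ : ActionOver X.hom Δ)
      (ActionOver.forall_exists_stableAffineOpen_of_isProjectiveOver _ hX)) P' := by
    rw [← hi, AlgPoints.map_comp_apply, AlgPoints.map_comp_apply, h]
  obtain ⟨g, hg⟩ := exists_pointsAction_eq_of_map_mk_eq _ _ h1
  refine ⟨g, ?_⟩
  rw [pointsAction_apply] at hg
  have hov : ((⟨((Over.forget _).mapAut X).comp act, fun g => Over.w (act g).hom⟩ : ActionOver X.hom Δ).overIso g).hom =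
      (act g).hom := Over.OverMorphism.ext rfl
  rwa [hov] at hg

end Points
/-! ### §2 `Δ` permutes the pieces of `X` -/
section Pieces

variable {Δ : Type} [Group Δ] {X : SchemeOver ℂ} (act : Δ →* Aut X)
  {σ' : Type} {Xp : σ' → SchemeOver ℂ} (ιX : ∀ j, Xp j ⟶ X)

/-- The legs of a colimit cofan in `SchemeOver ℂ` are monomorphisms (open immersions of the underlying schemes).
[cite: GortzWedhorn2020, §(3.5) Proposition 3.10 and Example 3.11 (disjoint union of schemes, p. 73)] -/
theorem mono_of_isColimit_cofan (hcX : IsColimit (Cofan.mk X ιX)) (j : σ') : Mono (ιX j) := by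
  obtain ⟨hc'⟩ := Literature.AlgebraicGeometry.Morphisms.isColimit_cofan_left hcX
  haveI : IsOpenImmersion (ιX j).left := Literature.AlgebraicGeometry.Morphisms.isOpenImmersion_of_isColimit_cofan hc' j
  haveI : Mono ((Over.forget _).map (ιX j)) := inferInstanceAs (Mono (ιX j).left)
  exact (Over.forget _).mono_of_mono_map (inferInstance)

/-- **Every translate of a piece lies in a piece**: `ιX j ≫ act g` factors through some leg `ιX j'` (the piece `Xp j` is connected and
non-empty, the legs are clopen). [cite: GortzWedhorn2020, Lemma 1.19 (1) (§(1.5)) with §(3.5) Example 3.11 (p. 73)] -/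
theorem exists_pieceLift (hcX : IsColimit (Cofan.mk X ιX)) [∀ j, IsIntegral (Xp j).left] (g : Δ) (j : σ') :
    ∃ (j' : σ') (u : Xp j ⟶ Xp j'), u ≫ ιX j' = ιX j ≫ (act g).hom := by
  obtain ⟨w⟩ := (inferInstance : Nonempty (Xp j).left)
  obtain ⟨hc'⟩ := Literature.AlgebraicGeometry.Morphisms.isColimit_cofan_left hcX
  obtain ⟨j', y, hy⟩ := Literature.AlgebraicGeometry.Morphisms.exists_eq_of_isColimit_cofan hc' ((ιX j ≫ (act g).hom).left w)
  obtain ⟨u, hu⟩ := Literature.AlgebraicGeometry.Morphisms.exists_fac_of_isColimit_cofan_of_mem hcX (ιX j ≫ (act g).hom) w j' ⟨y, hy⟩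
  exact ⟨j', u, hu⟩

/-- **The piece through which a morphism from a non-empty scheme factors is unique.**
[cite: GortzWedhorn2020, §(3.5) Proposition 3.10 and Example 3.11 (disjoint union of schemes, p. 73)] -/
theorem pieceIndex_unique (hcX : IsColimit (Cofan.mk X ιX)) {T : SchemeOver ℂ} [Nonempty T.left] {q : T ⟶ X} {j₁ j₂ : σ'}
    (u₁ : T ⟶ Xp j₁) (u₂ : T ⟶ Xp j₂) (h₁ : u₁ ≫ ιX j₁ = q) (h₂ : u₂ ≫ ιX j₂ = q) : j₁ = j₂ := by
  obtain ⟨hc'⟩ := Literature.AlgebraicGeometry.Morphisms.isColimit_cofan_left hcX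
  exact Literature.AlgebraicGeometry.Morphisms.cofanFac_index_unique hc' (p := q.left) u₁.left u₂.left
    (by rw [← Over.comp_left, h₁]) (by rw [← Over.comp_left, h₂])

/-- **The lift through a piece is unique.** [cite: GortzWedhorn2020, §(3.5) Proposition 3.10 and Example 3.11 (disjoint union of schemes, p. 73)] -/
theorem pieceLift_unique (hcX : IsColimit (Cofan.mk X ιX)) {T : SchemeOver ℂ} {j : σ'} (u₁ u₂ : T ⟶ Xp j)
    (h : u₁ ≫ ιX j = u₂ ≫ ιX j) : u₁ = u₂ := by
  haveI := mono_of_isColimit_cofan ιX hcX j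
  exact (cancel_mono (ιX j)).1 h

/-- `(act g).hom ≫ (act g⁻¹).hom = 𝟙` (the group `Aut X` composes in the opposite order, `Aut.Aut_mul_def`). [folklore] -/
private theorem act_hom_comp_act_inv_hom (g : Δ) : (act g).hom ≫ (act g⁻¹).hom = 𝟙 X := by
  have h : act g⁻¹ * act g = 1 := by rw [← map_mul, inv_mul_cancel, map_one]
  calc (act g).hom ≫ (act g⁻¹).hom = (act g⁻¹ * act g).hom := rfl
    _ = (1 : Aut X).hom := by rw [h]
    _ = 𝟙 X := rfl

/-- **A lift of `act g` through the SAME piece is an automorphism of the piece** whose inverse lifts `act g⁻¹`: if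
`u ≫ ιX j = ιX j ≫ act g` then `u = h.hom` for some `h : Aut (Xp j)` with `h.inv ≫ ιX j = ιX j ≫ act g⁻¹`.
[cite: GortzWedhorn2020, §(3.5) Proposition 3.10 and Example 3.11 (disjoint union of schemes, p. 73)] -/
theorem exists_aut_of_pieceLift (hcX : IsColimit (Cofan.mk X ιX)) [∀ j, IsIntegral (Xp j).left] {g : Δ} {j : σ'}
    (u : Xp j ⟶ Xp j) (hu : u ≫ ιX j = ιX j ≫ (act g).hom) :
    ∃ h : Aut (Xp j), h.hom = u ∧ h.inv ≫ ιX j = ιX j ≫ (act g⁻¹).hom := by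
  -- the lift of `act g⁻¹` lands in the piece `j` as well
  obtain ⟨j', v, hv⟩ := exists_pieceLift act ιX hcX g⁻¹ j
  have huv : (u ≫ v) ≫ ιX j' = ιX j := by
    rw [Category.assoc, hv, reassoc_of% hu, act_hom_comp_act_inv_hom, Category.comp_id]
  have hj : j' = j := pieceIndex_unique ιX hcX (u ≫ v) (𝟙 _) huv (Category.id_comp _)
  subst hj
  have h1 : u ≫ v = 𝟙 _ := pieceLift_unique ιX hcX _ _ (by rw [huv, Category.id_comp])
  have hvu : (v ≫ u) ≫ ιX j' = ιX j' := by
    have h := act_hom_comp_act_inv_hom act g⁻¹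
    rw [inv_inv] at h
    rw [Category.assoc, hu, reassoc_of% hv, h, Category.comp_id]
  have h2 : v ≫ u = 𝟙 _ := pieceLift_unique ιX hcX _ _ (by rw [hvu, Category.id_comp])
  exact ⟨⟨u, v, h1, h2⟩, rfl, hv⟩

end Pieces
/-! ### §3 The piecewise quotient -/
section Piecewise

variable {Δ : Type} [Group Δ] [Finite Δ] {X Y : SchemeOver ℂ} (act : Δ →* Aut X) (p : X ⟶ Y)
  {σ σ' : Type} {Xp : σ' → SchemeOver ℂ} (ιX : ∀ j, Xp j ⟶ X) {Yp : σ → SchemeOver ℂ} (ιY : ∀ i, Yp i ⟶ Y)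

/-- **THE PIECEWISE QUOTIENT.**  Let `p : X ⟶ Y` be a quotient of the projective `X` by the finite `Δ` for separated test objects, `Y`
separated, `X = ∐ Xp j` and `Y = ∐ Yp i` coproducts of integral pieces, the `Xp j` projective and the `Yp i` smooth and separated, and let
`t j : Xp j ⟶ Yp (φ j)` be the piece map over `p` (`t j ≫ ιY (φ j) = ιX j ≫ p`), ONTO on complex points.  Then the lifts through `Xp j`
of the elements of `Δ` stabilising the piece form a FINITE subgroup `H ≤ Aut (Xp j)` and `t j` is a quotient of `Xp j` by `H` for
separated test objects.  (Recognition ★ `isSepQuotient_of_isProper_of_bijective`: `t j` is proper and `H`-invariant, its target is smooth and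
integral, and two complex points of `Xp j` with the same image differ by an element of `Δ` (§1) which stabilises the piece (§2).)
[cite: SGA1, Exp. V §1 Prop. 1.1, 1.8] [cite: MumfordAV1970, §7 Thm. p. 66 (Remark)] [cite: Springer1998, Thm. 5.2.8 (p. 85)] -/
theorem exists_subgroup_isSepQuotient_pieceMap (hX : IsProjectiveOver X) (hY : IsSeparated Y.hom)
    (hp : IsSepQuotient (fun g => act g) p)
    (hcX : IsColimit (Cofan.mk X ιX)) (hcY : IsColimit (Cofan.mk Y ιY))
    (hXp : ∀ j, IsProjectiveOver (Xp j)) [∀ j, IsIntegral (Xp j).left]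
    (hYp : ∀ i, IsSeparated (Yp i).hom) [∀ i, IsIntegral (Yp i).left] [∀ i, Smooth (Yp i).hom]
    (φ : σ' → σ) (t : ∀ j, Xp j ⟶ Yp (φ j)) (ht : ∀ j, t j ≫ ιY (φ j) = ιX j ≫ p)
    (j : σ') (hsurj : Function.Surjective (AlgPoints.map (L := ℂ) (t j))) :
    ∃ H : Subgroup (Aut (Xp j)),
      Finite H ∧
      (∀ h ∈ H, ∃ g : Δ, h.hom ≫ ιX j = ιX j ≫ (act g).hom) ∧
      (∀ (g : Δ) (u : Xp j ⟶ Xp j), u ≫ ιX j = ιX j ≫ (act g).hom → ∃ h ∈ H, h.hom = u) ∧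
      IsSepQuotient (fun h : ↥H => (h : Aut (Xp j))) (t j) := by
  classical
  -- instances on the piece and its target
  haveI : IsProper (Xp j).hom := (hXp j).isProper
  haveI : IsSeparated (Yp (φ j)).hom := hYp (φ j)
  haveI hmonoY : Mono (ιY (φ j)) := mono_of_isColimit_cofan ιY hcY (φ j)
  haveI hmonoX : Mono (ιX j) := mono_of_isColimit_cofan ιX hcX j
  haveI : IsProper (t j).left := by
    haveI : IsProper ((t j).left ≫ (Yp (φ j)).hom) := by rw [Over.w (t j)]; infer_instance
    exact IsProper.of_comp (t j).left (Yp (φ j)).hom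
  -- the subgroup of lifts
  let H : Subgroup (Aut (Xp j)) :=
    { carrier := {h | ∃ g : Δ, h.hom ≫ ιX j = ιX j ≫ (act g).hom}
      one_mem' := ⟨1, by rw [map_one]; change 𝟙 _ ≫ ιX j = ιX j ≫ 𝟙 _; simp⟩
      mul_mem' := by
        rintro a b ⟨ga, ha⟩ ⟨gb, hb⟩
        refine ⟨ga * gb, ?_⟩
        rw [map_mul]
        change (b.hom ≫ a.hom) ≫ ιX j = ιX j ≫ ((act gb).hom ≫ (act ga).hom)
        rw [Category.assoc, ha, reassoc_of% hb]
      inv_mem' := by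
        rintro a ⟨ga, ha⟩
        refine ⟨ga⁻¹, ?_⟩
        change a.inv ≫ ιX j = ιX j ≫ (act ga⁻¹).hom
        rw [Iso.inv_comp_eq, reassoc_of% ha, act_hom_comp_act_inv_hom, Category.comp_id] }
  have hHmem : ∀ h : Aut (Xp j), h ∈ H ↔ ∃ g : Δ, h.hom ≫ ιX j = ιX j ≫ (act g).hom := fun _ => Iff.rfl
  -- `H` is finite: an element is determined by the `g` it lifts
  have hfin : Finite H := by
    let f : H → Δ := fun h => Classical.choose ((hHmem h.1).1 h.2)
    have hf : ∀ h : H, (h : Aut (Xp j)).hom ≫ ιX j = ιX j ≫ (act (f h)).hom := fun h => Classical.choose_spec ((hHmem h.1).1 h.2)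
    refine Finite.of_injective f fun a b hab => ?_
    apply Subtype.ext
    apply Aut.ext
    exact (cancel_mono (ιX j)).1 (by rw [hf a, hf b, hab])
  haveI := hfin
  refine ⟨H, hfin, fun h hh => (hHmem h).1 hh, fun g u hu => ?_, ?_⟩
  · obtain ⟨h, hh, -⟩ := exists_aut_of_pieceLift act ιX hcX u hu
    exact ⟨h, (hHmem h).2 ⟨g, by rw [hh, hu]⟩, hh⟩
  -- recognition
  · have hinv : ∀ h : H, ((H.subtype h) : Aut (Xp j)).hom ≫ t j = t j := by
      intro h
      obtain ⟨g, hg⟩ := (hHmem h.1).1 h.2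
      apply (cancel_mono (ιY (φ j))).1
      rw [Category.assoc, ht j, Subgroup.coe_subtype, reassoc_of% hg, hp.hom_comp g]
    have hcov := ActionOver.forall_exists_stableAffineOpen_of_isProjectiveOver
      (⟨((Over.forget _).mapAut (Xp j)).comp H.subtype, fun h => Over.w (H.subtype h).hom⟩ : ActionOver (Xp j).hom H) (hXp j)
    have horb : ∀ P P' : ComplexPoints (Xp j), AlgPoints.map (t j) P = AlgPoints.map (t j) P' →
        ∃ h : H, AlgPoints.map (H.subtype h).hom P = P' := by
      intro P P' hPP'
      have h1 : AlgPoints.map p (AlgPoints.map (ιX j) P) = AlgPoints.map p (AlgPoints.map (ιX j) P') := by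
        rw [← AlgPoints.map_comp_apply, ← AlgPoints.map_comp_apply, ← ht j, AlgPoints.map_comp_apply, AlgPoints.map_comp_apply, hPP']
      obtain ⟨g, hg⟩ := IsSepQuotient.exists_map_act_eq_of_map_eq act p hX hY hp h1
      obtain ⟨j', u, hu⟩ := exists_pieceLift act ιX hcX g j
      -- the piece `j'` is `j`: the point `u(P)` of `Xp j'` and the point `P'` of `Xp j` have the same image in `X`
      have hpt : AlgPoints.map (ιX j') (AlgPoints.map u P) = AlgPoints.map (ιX j) P' := by
        rw [← AlgPoints.map_comp_apply, hu, AlgPoints.map_comp_apply, hg]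
      have hj : j' = j := pieceIndex_unique ιX hcX (T := specOver ℂ ℂ) (q := AlgPoints.map (ιX j) P')
        (AlgPoints.map u P) P' hpt rfl
      subst hj
      obtain ⟨h, hh, -⟩ := exists_aut_of_pieceLift act ιX hcX u hu
      refine ⟨⟨h, (hHmem h).2 ⟨g, by rw [hh, hu]⟩⟩, ?_⟩
      apply (cancel_mono (ιX j')).1
      change AlgPoints.map (ιX j') (AlgPoints.map h.hom P) = AlgPoints.map (ιX j') P'
      rw [hh, hpt]
    exact isSepQuotient_of_isProper_of_bijective H.subtype (t j) hcov hinv hsurj horb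

end Piecewise
/-! ### §4 The piece map is ONTO on complex points (irreducibility of the target piece) -/
section Surjective

variable {Δ : Type} [Group Δ] [Finite Δ] {X Y : SchemeOver ℂ} (act : Δ →* Aut X) (p : X ⟶ Y)
  {σ σ' : Type} [Fintype σ'] {Xp : σ' → SchemeOver ℂ} (ιX : ∀ j, Xp j ⟶ X) {Yp : σ → SchemeOver ℂ} (ιY : ∀ i, Yp i ⟶ Y)

/-- A complex point of `W` whose underlying (closed) point lies in the image of `f : T ⟶ W` (both locally of finite type over `ℂ`) is the
image of a complex point of `T`: the fibre is a non-empty closed subset of the Jacobson space `T`, so it contains a closed point, which carries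
a complex point (Nullstellensatz). [cite: SGA1, Exp. V, Prop. 1.1] -/
theorem exists_map_eq_of_pt_mem_range {T W : SchemeOver ℂ} [LocallyOfFiniteType T.hom] [LocallyOfFiniteType W.hom] (f : T ⟶ W)
    (y : ComplexPoints W) (hy : y.pt ∈ Set.range f.left) : ∃ Q : ComplexPoints T, AlgPoints.map f Q = y := by
  haveI : JacobsonSpace T.left := LocallyOfFiniteType.jacobsonSpace T.hom
  have hF : IsClosed (f.left ⁻¹' {y.pt} : Set T.left) := y.isClosed_singleton_pt.preimage f.left.continuous
  obtain ⟨x₀, hx₀⟩ := hy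
  obtain ⟨x, hxF, hxc⟩ := nonempty_inter_closedPoints (Z := (f.left ⁻¹' {y.pt} : Set T.left)) ⟨x₀, hx₀⟩ hF.isLocallyClosed
  obtain ⟨Q, hQ⟩ := AlgPoints.exists_pt_eq_of_isClosed_singleton (X := T) (K := ℂ) ((mem_closedPoints_iff).1 hxc)
  refine ⟨Q, AlgPoints.eq_of_pt_eq ?_⟩
  rw [AlgPoints.pt_map, hQ]
  exact hxF

/-- A non-empty `ℂ`-scheme locally of finite type has a complex point. [folklore] -/
private theorem nonempty_complexPoints {T : SchemeOver ℂ} [LocallyOfFiniteType T.hom] [Nonempty T.left] : Nonempty (ComplexPoints T) := by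
  haveI : JacobsonSpace T.left := LocallyOfFiniteType.jacobsonSpace T.hom
  obtain ⟨x₀⟩ := (inferInstance : Nonempty T.left)
  obtain ⟨x, -, hxc⟩ := nonempty_inter_closedPoints (Z := (Set.univ : Set T.left)) ⟨x₀, Set.mem_univ _⟩ isClosed_univ.isLocallyClosed
  obtain ⟨Q, -⟩ := AlgPoints.exists_pt_eq_of_isClosed_singleton (X := T) (K := ℂ) ((mem_closedPoints_iff).1 hxc)
  exact ⟨Q⟩

/-- **THE PIECE MAP IS ONTO ON COMPLEX POINTS.**  With `p : X ⟶ Y` a quotient of the projective `X` by the finite `Δ` for separated test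
objects, `Y` separated, `X = ∐_{j ∈ σ′} Xp j` (finitely many integral projective pieces), `Y = ∐ Yp i` (integral pieces) and piece maps
`t j ≫ ιY (φ j) = ιX j ≫ p`, every `t j (ℂ)` is surjective.  Proof: the images `(ιX j′ ≫ p)(Xp j′)` are closed and cover `Y` (`p` is onto),
so the IRREDUCIBLE piece `ιY (φ j) (Yp (φ j))` lies in ONE of them, say of `j₀`; a point of `Xp j` and a point of `Xp j₀` with the same image
differ by some `g ∈ Δ` (§1), and `act g` carries the piece `Xp j₀` into the piece `Xp j` (§2), so every complex point of `Yp (φ j)` is hit.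
[cite: SGA1, Exp. V §1 Prop. 1.1] [cite: GortzWedhorn2020, §(3.5) Proposition 3.10 and Example 3.11 (disjoint union of schemes, p. 73)] -/
theorem surjective_map_pieceMap (hX : IsProjectiveOver X) (hY : IsSeparated Y.hom)
    (hp : IsSepQuotient (fun g => act g) p)
    (hcX : IsColimit (Cofan.mk X ιX)) (hcY : IsColimit (Cofan.mk Y ιY))
    (hXp : ∀ j, IsProjectiveOver (Xp j)) [∀ j, IsIntegral (Xp j).left]
    (hYp : ∀ i, IsSeparated (Yp i).hom) [∀ i, IsIntegral (Yp i).left]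
    (φ : σ' → σ) (t : ∀ j, Xp j ⟶ Yp (φ j)) (ht : ∀ j, t j ≫ ιY (φ j) = ιX j ≫ p) (j : σ') :
    Function.Surjective (AlgPoints.map (L := ℂ) (t j)) := by
  classical
  -- instances
  haveI : IsProper X.hom := hX.isProper
  haveI : IsSeparated X.hom := inferInstance
  haveI : ∀ j', IsProper (Xp j').hom := fun j' => (hXp j').isProper
  haveI hmonoY : Mono (ιY (φ j)) := mono_of_isColimit_cofan ιY hcY (φ j)
  obtain ⟨hcX'⟩ := Literature.AlgebraicGeometry.Morphisms.isColimit_cofan_left hcX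
  obtain ⟨hcY'⟩ := Literature.AlgebraicGeometry.Morphisms.isColimit_cofan_left hcY
  -- `Y ≅ X/Δ`: `Y` is locally of finite type and `p` is surjective
  obtain ⟨i, hi⟩ := isoFiniteQuotient_of_isSepQuotient hX act p hY hp
  haveI hiso : IsIso i.hom.left := inferInstanceAs (IsIso ((Over.forget _).map i.hom))
  haveI : LocallyOfFiniteType Y.hom := by
    haveI := locallyOfFiniteType_finiteQuotient_hom
      (⟨((Over.forget _).mapAut X).comp act, fun g => Over.w (act g).hom⟩ : ActionOver X.hom Δ)
    have h := (inferInstance : LocallyOfFiniteType (i.hom.left ≫ (finiteQuotient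
      (⟨((Over.forget _).mapAut X).comp act, fun g => Over.w (act g).hom⟩ : ActionOver X.hom Δ)).hom))
    rwa [Over.w i.hom] at h
  haveI : ∀ i', LocallyOfFiniteType (Yp i').hom := fun i' => by
    haveI : IsOpenImmersion (ιY i').left := Literature.AlgebraicGeometry.Morphisms.isOpenImmersion_of_isColimit_cofan hcY' i'
    have h := (inferInstance : LocallyOfFiniteType ((ιY i').left ≫ Y.hom))
    rwa [Over.w (ιY i')] at h
  have hpsurj : Function.Surjective p.left := by
    intro y
    obtain ⟨x, hx⟩ := finiteQuotient.mk_left_surjective _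
      (ActionOver.forall_exists_stableAffineOpen_of_isProjectiveOver _ hX) (i.hom.left y)
    refine ⟨x, i.hom.left.isOpenEmbedding.injective ?_⟩
    rw [← Scheme.Hom.comp_apply, ← Over.comp_left, hi, hx]
  -- the closed images `R j′` of the pieces of `X` cover `Y`
  have hproper : ∀ j', IsProper (t j').left := fun j' => by
    haveI : IsSeparated (Yp (φ j')).hom := hYp (φ j')
    haveI : IsProper ((t j').left ≫ (Yp (φ j')).hom) := by rw [Over.w (t j')]; infer_instance
    exact IsProper.of_comp (t j').left (Yp (φ j')).hom
  have hRclosed : ∀ j', IsClosed (Set.range (ιX j' ≫ p).left) := fun j' => by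
    haveI := hproper j'
    haveI : IsOpenImmersion (ιY (φ j')).left := Literature.AlgebraicGeometry.Morphisms.isOpenImmersion_of_isColimit_cofan hcY' (φ j')
    have hce : Topology.IsClosedEmbedding (ιY (φ j')).left :=
      ⟨(ιY (φ j')).left.isOpenEmbedding.isEmbedding,
        (Literature.AlgebraicGeometry.Morphisms.isClopen_range_of_isColimit_cofan hcY' (φ j')).isClosed⟩
    rw [← ht j', Over.comp_left, Scheme.Hom.comp_base, TopCat.coe_comp, Set.range_comp]
    exact hce.isClosedMap _ (t j').left.isClosedMap.isClosed_range
  have hcover : ∀ y : Y.left, ∃ j', y ∈ Set.range (ιX j' ≫ p).left := fun y => by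
    obtain ⟨x, rfl⟩ := hpsurj y
    obtain ⟨j', x', rfl⟩ := Literature.AlgebraicGeometry.Morphisms.exists_eq_of_isColimit_cofan hcX' x
    exact ⟨j', x', by rw [Over.comp_left, Scheme.Hom.comp_apply]⟩
  -- the irreducible piece `S = ιY (φ j) (Yp (φ j))` lies in ONE `R j₀`
  have hS : IsIrreducible (Set.range (ιY (φ j)).left) := by
    rw [← Set.image_univ]
    exact (IrreducibleSpace.isIrreducible_univ _).image _ (ιY (φ j)).left.continuous.continuousOn
  obtain ⟨z, hz, hSz⟩ := (isIrreducible_iff_sUnion_isClosed.1 hS) (Finset.univ.image fun j' => Set.range (ιX j' ≫ p).left)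
    (by
      intro z hz
      obtain ⟨j', -, rfl⟩ := Finset.mem_image.1 hz
      exact hRclosed j')
    (by
      intro y _
      obtain ⟨j', hj'⟩ := hcover y
      exact Set.mem_sUnion.2 ⟨_, Finset.mem_coe.2 (Finset.mem_image.2 ⟨j', Finset.mem_univ _, rfl⟩), hj'⟩)
  obtain ⟨j₀, -, rfl⟩ := Finset.mem_image.1 hz
  -- a point `P` of `Xp j` and a point `Q` of `Xp j₀` over the same point of `Y`; `act g` carries `Xp j₀` into `Xp j`
  obtain ⟨P⟩ := nonempty_complexPoints (T := Xp j)
  have hPS : (AlgPoints.map (ιX j ≫ p) P).pt ∈ Set.range (ιY (φ j)).left := by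
    rw [← ht j, AlgPoints.pt_map, Over.comp_left, Scheme.Hom.comp_apply]
    exact ⟨_, rfl⟩
  obtain ⟨Q, hQ⟩ := exists_map_eq_of_pt_mem_range (ιX j₀ ≫ p) (AlgPoints.map (ιX j ≫ p) P) (hSz hPS)
  rw [AlgPoints.map_comp_apply, AlgPoints.map_comp_apply] at hQ
  obtain ⟨g, hg⟩ := IsSepQuotient.exists_map_act_eq_of_map_eq act p hX hY hp hQ
  obtain ⟨j₃, u, hu⟩ := exists_pieceLift act ιX hcX g j₀
  have hpt : AlgPoints.map (ιX j₃) (AlgPoints.map u Q) = AlgPoints.map (ιX j) P := by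
    rw [← AlgPoints.map_comp_apply, hu, AlgPoints.map_comp_apply, hg]
  have hj : j₃ = j := pieceIndex_unique ιX hcX (T := specOver ℂ ℂ) (q := AlgPoints.map (ιX j) P) (AlgPoints.map u Q) P hpt rfl
  subst hj
  -- every complex point of `Yp (φ j)` is hit
  intro y₀
  have hyS : (AlgPoints.map (ιY (φ j₃)) y₀).pt ∈ Set.range (ιY (φ j₃)).left := by
    rw [AlgPoints.pt_map]; exact ⟨_, rfl⟩
  obtain ⟨Q', hQ'⟩ := exists_map_eq_of_pt_mem_range (ιX j₀ ≫ p) _ (hSz hyS)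
  refine ⟨AlgPoints.map u Q', ?_⟩
  apply (cancel_mono (ιY (φ j₃))).1
  change AlgPoints.map (ιY (φ j₃)) (AlgPoints.map (t j₃) (AlgPoints.map u Q')) = AlgPoints.map (ιY (φ j₃)) y₀
  rw [← AlgPoints.map_comp_apply, ht j₃, ← AlgPoints.map_comp_apply, ← Category.assoc, hu, Category.assoc, hp.hom_comp g, hQ']

/-- **THE PIECEWISE QUOTIENT, hypothesis-free form**: §3 `exists_subgroup_isSepQuotient_pieceMap` with its surjectivity hypothesis discharged by
`surjective_map_pieceMap` (finitely many pieces).  For every piece `Xp j` there is a finite subgroup `H ≤ Aut (Xp j)` — the lifts of the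
elements of `Δ` stabilising the piece — such that the piece map `t j : Xp j ⟶ Yp (φ j)` is a quotient of `Xp j` by `H` for separated test
objects. [cite: SGA1, Exp. V §1 Prop. 1.1, 1.8] [cite: MumfordAV1970, §7 Thm. p. 66 (Remark)] [cite: Springer1998, Thm. 5.2.8 (p. 85)] -/
theorem exists_subgroup_isSepQuotient_pieceMap' (hX : IsProjectiveOver X) (hY : IsSeparated Y.hom)
    (hp : IsSepQuotient (fun g => act g) p)
    (hcX : IsColimit (Cofan.mk X ιX)) (hcY : IsColimit (Cofan.mk Y ιY))
    (hXp : ∀ j, IsProjectiveOver (Xp j)) [∀ j, IsIntegral (Xp j).left]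
    (hYp : ∀ i, IsSeparated (Yp i).hom) [∀ i, IsIntegral (Yp i).left] [∀ i, Smooth (Yp i).hom]
    (φ : σ' → σ) (t : ∀ j, Xp j ⟶ Yp (φ j)) (ht : ∀ j, t j ≫ ιY (φ j) = ιX j ≫ p) (j : σ') :
    ∃ H : Subgroup (Aut (Xp j)),
      Finite H ∧
      (∀ h ∈ H, ∃ g : Δ, h.hom ≫ ιX j = ιX j ≫ (act g).hom) ∧
      (∀ (g : Δ) (u : Xp j ⟶ Xp j), u ≫ ιX j = ιX j ≫ (act g).hom → ∃ h ∈ H, h.hom = u) ∧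
      IsSepQuotient (fun h : ↥H => (h : Aut (Xp j))) (t j) :=
  exists_subgroup_isSepQuotient_pieceMap act p ιX ιY hX hY hp hcX hcY hXp hYp φ t ht j
    (surjective_map_pieceMap act p ιX ιY hX hY hp hcX hcY hXp hYp φ t ht j)

end Surjective

end Literature.AlgebraicGeometry.Motives
end
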